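import Mathlib
import Summits.Ventures.PercRepro2.SwOutMixedPiecesDefs

/-!
# The several-arms raw cube: vocabulary (blind cell PercRepro2, night-4 g20, 2026-08-27;
proofs/NIGHT4-G20.md §4)

The big block of a single junction `u` with SEVERAL mixed arms: arms `r : ρ`, each with a single
dropped vertex `p_r` joined to `u`, with PIECES `i : ν` of the h-pieces assigned to arms by
`arm : ν → ρ` (an arm without pieces is a PURE arm, joined to `u` only), outside edges `e_r` at
`p_r`, the u-arms `s : ι` and the far arms `f : κ`.  A point of the raw cube is
`(s, a, uP, e, f)` with `a : ν → Bool` (the pieces), `uP e : ρ → Bool` (the u–p_r edges, the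
outside edges of `p_r` BLUE).  The red edge set is `{U_j : s_j} ∪ {u : ∃ j, s_j} ∪ {A_i : a_i} ∪
{P_r : (∃ j, s_j) ∧ uP_r} ∪ {F_k : f_k}` (`ER`, independent of `arm`), the blue set the red set of the
flipped point, and a point LEAKS at an arm `r` when `p_r` is in the hull of `h` on one side while
its outside edges or one of its pieces are on the other side (`LeakArm`, `Leak = ∃ r, LeakArm r`).
With at least one u-arm, the non-leaking points are the CORE points (every arm uniform:
`a_i = uP_r = e_r` on the pieces of `r`), the T-SLAB (`s = ⊤`, every arm dropped or attached red)
and the B-SLAB (`s = ⊥`, every arm attached red or attached blue) — `not_leak_iff`.  `G5` is the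
X-move at an all-dropped point.  One arm with one piece type is `MixedPieces`; one arm without
pieces is a pendant vertex.
-/

namespace Summit.Ventures.PercRepro2

namespace MixedArms

open scoped Classical

variable {ι ρ ν κ : Type*}

/-- A point of the several-arms raw cube: `(s, a, uP, e, f)`. -/
abbrev PtR (ι ρ ν κ : Type*) := Config ι × Config ν × (ρ → Bool) × (ρ → Bool) × Config κ

/-- The atoms: the u-arms, `u`, the pieces, the dropped vertices, the far arms. -/
abbrev AtomR (ι ρ ν κ : Type*) := ι ⊕ (Unit ⊕ (ν ⊕ (ρ ⊕ κ)))

/-- The atom of the far arm `k`. -/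
def fA (k : κ) : AtomR ι ρ ν κ := Sum.inr (Sum.inr (Sum.inr (Sum.inr k)))

section Defs

variable (p : PtR ι ρ ν κ)

/-- The red edge set of a point (as a predicate on atoms). -/
def ER : Set (AtomR ι ρ ν κ) := fun x =>
  match x with
  | Sum.inl j => p.1 j = true
  | Sum.inr (Sum.inl ()) => ∃ j, p.1 j = true
  | Sum.inr (Sum.inr (Sum.inl i)) => p.2.1 i = true
  | Sum.inr (Sum.inr (Sum.inr (Sum.inl r))) => (∃ j, p.1 j = true) ∧ p.2.2.1 r = true
  | Sum.inr (Sum.inr (Sum.inr (Sum.inr k))) => p.2.2.2.2 k = true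

/-- The total flip of a point. -/
def flipPt : PtR ι ρ ν κ :=
  (flipAll p.1, flipAll p.2.1, fun r => !p.2.2.1 r, fun r => !p.2.2.2.1 r, flipAll p.2.2.2.2)

/-- The blue edge set: the red edge set of the flipped point. -/
def EB : Set (AtomR ι ρ ν κ) := ER (flipPt p)

variable (arm : ν → ρ)

/-- The point leaks at the arm `r`. -/
def LeakArm (r : ρ) : Prop :=
  ((∃ j, p.1 j = true) ∧ p.2.2.1 r = true ∧
      (p.2.2.2.1 r = false ∨ ∃ i, arm i = r ∧ p.2.1 i = false)) ∨
    ((∃ j, p.1 j = false) ∧ p.2.2.1 r = false ∧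
      (p.2.2.2.1 r = true ∨ ∃ i, arm i = r ∧ p.2.1 i = true))

/-- The leaking points. -/
def Leak : Prop := ∃ r, LeakArm p arm r

/-- The core points: every arm uniform. -/
def Core : Prop := (∀ i, p.2.1 i = p.2.2.1 (arm i)) ∧ ∀ r, p.2.2.1 r = p.2.2.2.1 r

/-- The T-slab: all u-arms red, every arm dropped or attached red. -/
def TSlab : Prop :=
  p.1 = (fun _ => true) ∧
    ∀ r, p.2.2.1 r = false ∨ ((∀ i, arm i = r → p.2.1 i = true) ∧ p.2.2.2.1 r = true)

/-- The B-slab: all u-arms blue, every arm attached red or attached blue. -/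
def BSlab : Prop :=
  p.1 = (fun _ => false) ∧
    ∀ r, p.2.2.1 r = true ∨ ((∀ i, arm i = r → p.2.1 i = false) ∧ p.2.2.2.1 r = false)

end Defs

/-- The property `G5` (the X-move at an all-dropped point): `(⊤, a, ⊥, e, f) ∈ Q` implies
`(⊥, a, ⊤, e, f) ∈ Q`. -/
def G5 (Q : Set (PtR ι ρ ν κ)) : Prop :=
  ∀ (a : Config ν) (e : ρ → Bool) (f : Config κ),
    ((fun _ => true), a, (fun _ => false), e, f) ∈ Q →
      ((fun _ => false), a, (fun _ => true), e, f) ∈ Q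

section Basic

/-- Membership of a u-arm in the red edge set (definitional). -/
lemma mem_ER_inl (p : PtR ι ρ ν κ) (j : ι) :
    (Sum.inl j : AtomR ι ρ ν κ) ∈ ER p ↔ p.1 j = true := Iff.rfl

/-- Membership of `u` in the red edge set (definitional). -/
lemma mem_ER_u (p : PtR ι ρ ν κ) :
    (Sum.inr (Sum.inl ()) : AtomR ι ρ ν κ) ∈ ER p ↔ ∃ j, p.1 j = true := Iff.rfl

/-- Membership of a piece in the red edge set (definitional). -/
lemma mem_ER_a (p : PtR ι ρ ν κ) (i : ν) :
    (Sum.inr (Sum.inr (Sum.inl i)) : AtomR ι ρ ν κ) ∈ ER p ↔ p.2.1 i = true := Iff.rfl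

/-- Membership of a dropped vertex in the red edge set (definitional). -/
lemma mem_ER_p (p : PtR ι ρ ν κ) (r : ρ) :
    (Sum.inr (Sum.inr (Sum.inr (Sum.inl r))) : AtomR ι ρ ν κ) ∈ ER p ↔
      (∃ j, p.1 j = true) ∧ p.2.2.1 r = true := Iff.rfl

/-- Membership of a far arm in the red edge set (definitional). -/
lemma mem_ER_f (p : PtR ι ρ ν κ) (k : κ) :
    (Sum.inr (Sum.inr (Sum.inr (Sum.inr k))) : AtomR ι ρ ν κ) ∈ ER p ↔ p.2.2.2.2 k = true :=
  Iff.rfl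

/-- The red edge set is monotone. -/
lemma ER_mono {p q : PtR ι ρ ν κ} (h : p ≤ q) : ER p ⊆ ER q := by
  obtain ⟨hs, ha, hu, -, hf⟩ := h
  intro x hx
  rcases x with j | ⟨⟨⟩⟩ | i | r | k
  · exact MixedPieces.true_le_imp (hs j) hx
  · obtain ⟨j, hj⟩ := hx
    exact ⟨j, MixedPieces.true_le_imp (hs j) hj⟩
  · exact MixedPieces.true_le_imp (ha i) hx
  · obtain ⟨⟨j, hj⟩, hp⟩ := hx
    exact ⟨⟨j, MixedPieces.true_le_imp (hs j) hj⟩, MixedPieces.true_le_imp (hu r) hp⟩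
  · exact MixedPieces.true_le_imp (hf k) hx

/-- The red edge set does not see the coordinate `e`. -/
lemma ER_eq_of_eq {p q : PtR ι ρ ν κ} (hs : p.1 = q.1) (ha : p.2.1 = q.2.1)
    (hu : p.2.2.1 = q.2.2.1) (hf : p.2.2.2.2 = q.2.2.2.2) : ER p = ER q := by
  ext x
  rcases x with j | ⟨⟨⟩⟩ | i | r | k
  · rw [mem_ER_inl, mem_ER_inl, hs]
  · rw [mem_ER_u, mem_ER_u, hs]
  · rw [mem_ER_a, mem_ER_a, ha]
  · rw [mem_ER_p, mem_ER_p, hs, hu]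
  · rw [mem_ER_f, mem_ER_f, hf]

/-- The total flip is an involution. -/
lemma flipPt_flipPt (p : PtR ι ρ ν κ) : flipPt (flipPt p) = p := by
  obtain ⟨s, a, uP, e, f⟩ := p
  simp only [flipPt, flipAll_involutive s, flipAll_involutive a, flipAll_involutive f,
    Bool.not_not]

variable (arm : ν → ρ)

/-- A core point does not leak. -/
lemma not_leak_of_core {p : PtR ι ρ ν κ} (hc : Core p arm) : ¬ Leak p arm := by
  rintro ⟨r, hr⟩
  obtain ⟨ha, hu⟩ := hc
  rcases hr with ⟨-, h2, h3 | ⟨i, hi, hi'⟩⟩ | ⟨-, h2, h3 | ⟨i, hi, hi'⟩⟩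
  · rw [← hu, h2] at h3
    exact absurd h3 (by decide)
  · rw [ha, hi, h2] at hi'
    exact absurd hi' (by decide)
  · rw [← hu, h2] at h3
    exact absurd h3 (by decide)
  · rw [ha, hi, h2] at hi'
    exact absurd hi' (by decide)

/-- A T-slab point does not leak. -/
lemma not_leak_of_tslab {p : PtR ι ρ ν κ} (ht : TSlab p arm) : ¬ Leak p arm := by
  rintro ⟨r, hr⟩
  obtain ⟨hs, hr'⟩ := ht
  rcases hr with ⟨-, h2, h3⟩ | ⟨⟨j, hj⟩, -, -⟩
  · rcases hr' r with h | ⟨h4, h5⟩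
    · rw [h2] at h
      exact absurd h (by decide)
    · rcases h3 with h3 | ⟨i, hi, hi'⟩
      · rw [h5] at h3
        exact absurd h3 (by decide)
      · rw [h4 i hi] at hi'
        exact absurd hi' (by decide)
  · rw [hs] at hj
    exact absurd hj Bool.false_ne_true.symm

/-- A B-slab point does not leak. -/
lemma not_leak_of_bslab {p : PtR ι ρ ν κ} (hb : BSlab p arm) : ¬ Leak p arm := by
  rintro ⟨r, hr⟩
  obtain ⟨hs, hr'⟩ := hb
  rcases hr with ⟨⟨j, hj⟩, -, -⟩ | ⟨-, h2, h3⟩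
  · rw [hs] at hj
    exact absurd hj Bool.false_ne_true
  · rcases hr' r with h | ⟨h4, h5⟩
    · rw [h2] at h
      exact absurd h (by decide)
    · rcases h3 with h3 | ⟨i, hi, hi'⟩
      · rw [h5] at h3
        exact absurd h3 (by decide)
      · rw [h4 i hi] at hi'
        exact absurd hi' (by decide)

/-- With a u-arm present, a non-leaking point is a core point, a T-slab point or a B-slab point. -/
lemma not_leak_iff [Nonempty ι] (p : PtR ι ρ ν κ) :
    ¬ Leak p arm ↔ Core p arm ∨ TSlab p arm ∨ BSlab p arm := by
  constructor
  · intro hL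
    have hL' : ∀ r, ¬ LeakArm p arm r := fun r hr => hL ⟨r, hr⟩
    by_cases hT : ∀ j, p.1 j = true
    · -- `s = ⊤`: every arm dropped or attached red
      refine Or.inr (Or.inl ⟨(MixedPieces.eq_const_true_iff _).1 hT, fun r => ?_⟩)
      cases hu : p.2.2.1 r
      · exact Or.inl rfl
      · right
        have hj : ∃ j, p.1 j = true := ⟨Classical.arbitrary ι, hT _⟩
        refine ⟨fun i hi => ?_, ?_⟩
        · by_contra hc
          exact hL' r (Or.inl ⟨hj, hu, Or.inr ⟨i, hi, by simpa using hc⟩⟩)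
        · by_contra hc
          exact hL' r (Or.inl ⟨hj, hu, Or.inl (by simpa using hc)⟩)
    · by_cases hB : ∀ j, p.1 j = false
      · -- `s = ⊥`: every arm attached red or attached blue
        refine Or.inr (Or.inr ⟨(MixedPieces.eq_const_false_iff _).1 hB, fun r => ?_⟩)
        cases hu : p.2.2.1 r
        · right
          have hj : ∃ j, p.1 j = false := ⟨Classical.arbitrary ι, hB _⟩
          refine ⟨fun i hi => ?_, ?_⟩
          · by_contra hc
            exact hL' r (Or.inr ⟨hj, hu, Or.inr ⟨i, hi, by simpa using hc⟩⟩)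
          · by_contra hc
            exact hL' r (Or.inr ⟨hj, hu, Or.inl (by simpa using hc)⟩)
        · exact Or.inl rfl
      · -- `s` mixed: every arm uniform
        have hj1 := MixedPieces.exists_eq_true_of_not_forall hB
        have hj0 := MixedPieces.exists_eq_false_of_not_forall hT
        left
        refine ⟨fun i => ?_, fun r => ?_⟩
        · cases hu : p.2.2.1 (arm i)
          · by_contra hc
            exact hL' (arm i) (Or.inr ⟨hj0, hu, Or.inr ⟨i, rfl, by simpa using hc⟩⟩)
          · by_contra hc
            exact hL' (arm i) (Or.inl ⟨hj1, hu, Or.inr ⟨i, rfl, by simpa using hc⟩⟩)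
        · cases hu : p.2.2.1 r
          · by_contra hc
            exact hL' r (Or.inr ⟨hj0, hu, Or.inl (by simpa using hc)⟩)
          · by_contra hc
            exact hL' r (Or.inl ⟨hj1, hu, Or.inl (by simpa using hc)⟩)
  · rintro (h | h | h)
    · exact not_leak_of_core arm h
    · exact not_leak_of_tslab arm h
    · exact not_leak_of_bslab arm h

end Basic

end MixedArms

end Summit.Ventures.PercRepro2
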